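import Mathlib
import Summits.PneNP.PneNP.Theorems.CnfIdealGenLengthRankDefectRepresentationsSimReduction

/-!
# Crux `RankDefectRepresentations` (stmt-PneNP-18923), line `rank-dehn-ladder`: QUASI-POLYNOMIAL SIM from the two-family cut lemma
# (registered stub `stub_simBoundQuasiPoly`, RESHAPE 5, lead g9)

The halving step `simBound_sum` (p652532): SIM bounds for the coordinate types `κ`, `κ'` and the two-family cut lemma
`TwoFamilyCutLemma K κ κ' λ` give a SIM bound for `κ ⊕ κ'` with constant `C₁ + C₂ + 2λ(2C₁ + 2C₂ + 1)`.  Here we iterate it along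
`Fin 2^{k+1} ≃ Fin 2^k ⊕ Fin 2^k`, starting from `simBound_unit : SimBound K (Fin 1) 0`: if the two-family cut lemma holds for all splits
`Fin a ⊕ Fin b` with constant `L (a+b+1)^e`, then `SimBound K (Fin 2^k) (2^{c (k+1)^2})` with `c := L + e + 4` — i.e. SIM (= MP_n, the
depth-2 core of N0b) is stable with constant `n^{O(log n)}`.  Tools: transport of `SimBound` along an equivalence of coordinate types
(`simBound_of_equiv`) and monotonicity in the constant (`simBound_mono`).  Purely bookkeeping; the open input is the two-family cut lemma
(⟸ `stub_doubleMaxCutDecomposition` by p653152).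
HONEST FRAMING: conditional, negative-lane tool; P ≠ NP is not moved; F-N2 is a FRONTIER formal rung.
-/

set_option linter.dupNamespace false -- `Summit.PneNP.PneNP.…`: summit = sub-problem name (D-0017)

namespace Summit.PneNP.PneNP.Theorems.CnfIdealGenLengthRankDefectRepresentationsSimBoundQuasiPoly

open Matrix
open Summit.PneNP.PneNP.Theorems.CnfIdealGenLengthRankDefectRepresentationsSimReduction
  (cut SimBound TwoFamilyCutLemma simBound_sum simBound_unit)

variable {K : Type} [Field K]

/-- `SimBound` is monotone in the constant. -/
theorem simBound_mono {κ : Type} {C C' : ℕ} (h : SimBound K κ C) (hle : C ≤ C') : SimBound K κ C' := by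
  intro ι ι' _ _ _ _ row col y t hsupp hcons
  obtain ⟨z, hz⟩ := h ι ι' row col y t hsupp hcons
  exact ⟨z, fun k => (hz k).trans (Nat.mul_le_mul_right _ hle)⟩

/-- `SimBound` transports along an equivalence of coordinate types (re-index colourings and data). -/
theorem simBound_of_equiv {κ κ' : Type} (e : κ ≃ κ') {C : ℕ} (h : SimBound K κ C) : SimBound K κ' C := by
  intro ι ι' _ _ _ _ row col y t hsupp hcons
  -- pull the instance back to `κ`
  have hcut : ∀ (k : κ) (M : Matrix ι ι' K),
      cut (fun x k => row x (e k)) (fun x k => col x (e k)) k M = cut row col (e k) M := fun _ _ => rfl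
  obtain ⟨z, hz⟩ := h ι ι' (fun x k => row x (e k)) (fun x k => col x (e k)) (fun k => y (e k)) t
    (fun k => by rw [hcut]; exact hsupp (e k)) (fun k l => by rw [hcut, hcut]; exact hcons (e k) (e l))
  refine ⟨z, fun k' => ?_⟩
  have := hz (e.symm k')
  rwa [hcut, Equiv.apply_symm_apply] at this

/-- One doubling step: `Fin 2^{k+1} ≃ Fin 2^k ⊕ Fin 2^k`. -/
theorem simBound_double {k C lam : ℕ} (h : SimBound K (Fin (2 ^ k)) C)
    (hTF : TwoFamilyCutLemma K (Fin (2 ^ k)) (Fin (2 ^ k)) lam) :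
    SimBound K (Fin (2 ^ (k + 1))) (C + C + 2 * lam * (2 * C + 2 * C + 1)) := by
  have hsum := simBound_sum h h hTF
  have e : Fin (2 ^ k) ⊕ Fin (2 ^ k) ≃ Fin (2 ^ (k + 1)) :=
    finSumFinEquiv.trans (finCongr (by ring))
  exact simBound_of_equiv e hsum

/-- Arithmetic of the doubling recursion: if `C + 1 ≤ 2^{c (k+1)^2}` with `c = L + e + 4` and `λ = L (2^k + 2^k + 1)^e`, then the next
constant satisfies `C' + 1 ≤ 2^{c (k+2)^2}`. -/
theorem step_bound (L e k C : ℕ) (hC : C + 1 ≤ 2 ^ ((L + e + 4) * (k + 1) ^ 2)) :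
    C + C + 2 * (L * (2 ^ k + 2 ^ k + 1) ^ e) * (2 * C + 2 * C + 1) + 1 ≤ 2 ^ ((L + e + 4) * (k + 2) ^ 2) := by
  set lam := L * (2 ^ k + 2 ^ k + 1) ^ e with hlam
  -- `λ ≤ L · 2^{(k+2) e}`
  have h1 : 2 ^ k + 2 ^ k + 1 ≤ 2 ^ (k + 2) := by
    have : 1 ≤ 2 ^ k := Nat.one_le_two_pow
    calc 2 ^ k + 2 ^ k + 1 ≤ 2 ^ k + 2 ^ k + (2 ^ k + 2 ^ k) := by omega
      _ = 2 ^ (k + 2) := by ring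
  have hlam_le : lam ≤ L * 2 ^ ((k + 2) * e) := by
    rw [hlam, pow_mul]
    exact Nat.mul_le_mul_left L (Nat.pow_le_pow_left h1 e)
  -- `12 (L+1) ≤ 2^{L+4}`
  have hL : 12 * (L + 1) ≤ 2 ^ (L + 4) := by
    have : L < 2 ^ L := Nat.lt_two_pow_self
    calc 12 * (L + 1) ≤ 16 * 2 ^ L := by omega
      _ = 2 ^ (L + 4) := by ring
  -- main estimate: new + 1 ≤ (C+1) (2 + 10 λ) ≤ 2^{c(k+1)²} · 12 (L+1) 2^{(k+2)e} ≤ 2^{c(k+2)²}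
  have h2 : C + C + 2 * lam * (2 * C + 2 * C + 1) + 1 ≤ (C + 1) * (2 + 10 * lam) := by nlinarith
  have h3 : 2 + 10 * lam ≤ 12 * (L + 1) * 2 ^ ((k + 2) * e) := by
    have : 1 ≤ 2 ^ ((k + 2) * e) := Nat.one_le_two_pow
    nlinarith
  have hexp : (L + e + 4) * (k + 1) ^ 2 + (L + 4) + (k + 2) * e ≤ (L + e + 4) * (k + 2) ^ 2 := by nlinarith
  calc C + C + 2 * lam * (2 * C + 2 * C + 1) + 1
      ≤ (C + 1) * (2 + 10 * lam) := h2
    _ ≤ 2 ^ ((L + e + 4) * (k + 1) ^ 2) * (12 * (L + 1) * 2 ^ ((k + 2) * e)) := Nat.mul_le_mul hC h3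
    _ ≤ 2 ^ ((L + e + 4) * (k + 1) ^ 2) * (2 ^ (L + 4) * 2 ^ ((k + 2) * e)) :=
        Nat.mul_le_mul_left _ (Nat.mul_le_mul_right _ hL)
    _ = 2 ^ ((L + e + 4) * (k + 1) ^ 2 + (L + 4) + (k + 2) * e) := by rw [← pow_add, ← pow_add]; ring_nf
    _ ≤ 2 ^ ((L + e + 4) * (k + 2) ^ 2) := Nat.pow_le_pow_right (by norm_num) hexp

/-- **Registered stub `stub_simBoundQuasiPoly`** (line `rank-dehn-ladder`, RESHAPE 5): the two-family cut lemma with a constant polynomial in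
the number of coordinates implies a QUASI-POLYNOMIAL SIM bound, `SimBound K (Fin 2^k) (2^{c (k+1)^2})`. -/
theorem stub_simBoundQuasiPoly :
    (∃ L e : ℕ, ∀ (K : Type) [Field K] (a b : ℕ),
      Summit.PneNP.PneNP.Theorems.CnfIdealGenLengthRankDefectRepresentationsSimReduction.TwoFamilyCutLemma
        K (Fin a) (Fin b) (L * (a + b + 1) ^ e)) →
    ∃ c : ℕ, ∀ (K : Type) [Field K] (k : ℕ),
      Summit.PneNP.PneNP.Theorems.CnfIdealGenLengthRankDefectRepresentationsSimReduction.SimBound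
        K (Fin (2 ^ k)) (2 ^ (c * (k + 1) ^ 2)) := by
  rintro ⟨L, e, hTF⟩
  refine ⟨L + e + 4, fun K _ k => ?_⟩
  -- invariant: a constant `C` with `C + 1 ≤ 2^{c (k+1)^2}`
  suffices h : ∃ C, C + 1 ≤ 2 ^ ((L + e + 4) * (k + 1) ^ 2) ∧ SimBound K (Fin (2 ^ k)) C by
    obtain ⟨C, hC, hS⟩ := h
    exact simBound_mono hS (by omega)
  induction k with
  | zero =>
      refine ⟨0, by simpa using Nat.one_le_two_pow, ?_⟩
      exact simBound_of_equiv (finCongr (by norm_num) : Fin 1 ≃ Fin (2 ^ 0)) simBound_unit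
  | succ k ih =>
      obtain ⟨C, hC, hS⟩ := ih
      refine ⟨C + C + 2 * (L * (2 ^ k + 2 ^ k + 1) ^ e) * (2 * C + 2 * C + 1), step_bound L e k C hC, ?_⟩
      have hTF' : TwoFamilyCutLemma K (Fin (2 ^ k)) (Fin (2 ^ k)) (L * (2 ^ k + 2 ^ k + 1) ^ e) := hTF K (2 ^ k) (2 ^ k)
      exact simBound_double hS hTF'

end Summit.PneNP.PneNP.Theorems.CnfIdealGenLengthRankDefectRepresentationsSimBoundQuasiPoly
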